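import Mathlib.Analysis.SpecialFunctions.Pow.Real
import Mathlib.Algebra.Order.BigOperators.Ring.Finset
import Mathlib.Algebra.BigOperators.Ring.Finset

/-!
# BalabanUVNodes ∕ N20·N19′·N21 — THE INDEPENDENT-BLOCK CARICATURE OF THE TWO RUNS' CLASS LAWS, FILE A: the Bhattacharyya ∕ Hellinger AFFINITY sandwiches the
# total variation of two finite laws (`1 − BC ≤ TV ≤ √(1 − BC²)`), the caricature's affinity is a POWER `u^n`, and the per-block affinity defect is the critic's statistic
# up to constants (`Λ₁∕4 ≤ 1 − u ≤ Λ₁∕2`, `Λ₁ = (q−p)²(1∕(p+q) + 1∕(2−p−q))`, CRIT-1's `λ₁ = (q−p)²∕(p+q) ≤ Λ₁ ≤ 2λ₁` for `p + q ≤ 1`)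

Cell `pub-ymgap` (HUMAN RULING D-0062 Track A; work-bound push D-0149, director-ym №197), width seat `pub-ymgap-dag-n20-w1` (gen 5) on node N20 = NE7b; key item K3⁷
`SpineGivenEndpointR13SepCoPH` = stmt-QuantumFields-20544 (`--kind proof --supports 20544 --as helper`); COUNT-NEUTRAL.  Bus: CLAIM-8 ∕ INTENT-12, FILE A (INBOX l.30022; split DECL-DELTA-12 l.30446; the
announced module split in two under the 400-line rule — FILE B `…N20BlockCaricatureLawSeparation` carries §4–§5: the one-step two-sided bound, the dichotomy along `K`, and
dag-n19-w4's `no_dial_rescues` BY NAME).  THEOREMS ONLY: no `def`, no `instance`, no `notation`, no `sorry`; imports Mathlib only.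

WHY.  The crux critic's triage of the idea card `window-key-core` EDITION 2 (`Cruxes/SpineGivenEndpointR13SepCoPH/CRIT-1-TRIAGE-window-key-core-ed2.md`, Rec. (b), addressed
«cdisprove ∕ dag-n20») and the card («Cheapest falsifier (EDITION 2)») reduce the negation side of K3⁷ v5 `stub_expansion13H` at its pin to ONE letter, LAW SEPARATION (LS) of the
two runs' across-class laws (dag-n19-w4 `…N19NoDialRescuesLawSeparated.no_dial_rescues`: (LS) ⇒ no `Bad ∕ W ∕ shA ∕ shB ∕ Wsh ∕ δ` serves the three faces), and then say:
«Equivalently in caricature letters: is `λ_K = n_K (q_K − p_K)²∕(p_K + q_K)` unbounded? … (modulo block independence)».  THE CARICATURE (the card's word): at step `K`, `n_K`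
level-1 blocks, each large-field INDEPENDENTLY with probability `p_K` under run A's class weights and `q_K` under run B's; classes = large-field CONFIGURATIONS `S ⊆ range n_K`;
carriers `T K := (range n_K).powerset`, `A K t S := p_K^{#S}(1 − p_K)^{n_K − #S}`, `B K t S := q_K^{#S}(1 − q_K)^{n_K − #S}` (totals `1`).  The kernel mechanism deciding (LS)
there is NOT the additive product radius of dag-n19-w2's `…N19TVProductBlocks` (`ρ₁ + ρ₂ − ρ₁ρ₂`, two blocks, every set — it cannot see the `√n` scale) but the MULTIPLICATIVE
Bhattacharyya affinity `BC = Σ √(A·B)`: over `n` independent blocks `BC = u^n` with `u = √(pq) + √((1−p)(1−q))` (`Finset.sum_pow_mul_eq_add_pow`), and `1 − BC ≤ TV ≤ √(1 − BC²)`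
(Le Cam).  THIS FILE supplies exactly those three ingredients; FILE B draws the dichotomy `1 − e^{−Λ∕4} ≤ TV ≤ √Λ` and its `K → ∞` form.
* §1 two finite laws on one index set [folklore]: `sum_min_le_affinity` (min ≤ geometric mean) · ★ `exists_subset_one_sub_affinity_le` (TV ≥ 1 − BC, witnessed by `{a < b}`) ·
  `abs_sub_le_half_sum_abs` · `sq_sum_abs_sub_le` (Cauchy–Schwarz on `|b − a| = |√b − √a|·(√b + √a)`) · `sum_sq_sqrt_sub` · `sum_sq_sqrt_add` · ★ `abs_sub_le_sqrt_one_sub_affinity_sq`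
  (TV ≤ √(1 − BC²), EVERY subset).
* §2 the caricature's sums [folklore]: `sum_config_eq_one` · `config_nonneg` · `sqrt_config_mul_config` · ★ `affinity_config_eq_pow` (`BC = u^n`).
* §3 one block [folklore]: `sq_sqrt_sub_sqrt_le` ∕ `div_two_le_sq_sqrt_sub_sqrt` (`(q−p)²∕(2(p+q)) ≤ (√p − √q)² ≤ (q−p)²∕(p+q)`; Lean's `x∕0 = 0` makes the degenerate block
  `p = q = 0` consistent) · `one_sub_affinity₁_eq` (the Hellinger identity) · ★ `stat_div_four_le_one_sub_affinity₁` · ★ `one_sub_affinity₁_le_stat_div_two` · `affinity₁_nonneg` ·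
  `stat₁_nonneg` · `stat₁_le_statSym₁` · `statSym₁_le_two_stat₁` (CRIT-1's one-sided `λ₁` against the symmetric `Λ₁`: equal up to a factor `2` in the rare-event regime `p + q ≤ 1`).

HONEST FRAMING.  [folklore] finite-sum probability (textbook Le Cam ∕ Hellinger affinity inequalities) on a CARICATURE — independent blocks and product Bernoulli class weights are
the card's simplification, NOT the record's `classSet₁₃ ∕ weightA₁₃ ∕ weightB₁₃` (untouched); (LS) AT THE RECORD, (XG′), (SAT′) remain UNDECIDED; proves NO estimate of Bałaban's;
refutes NO registered stub; nothing of Bałaban's asserted or instantiated.  NE7 ∕ NE7b ∕ NE7c NOT PRINTED for `d = 4`, NOT proved; N19 ∕ N20 ∕ N21 NOT discharged; K3⁷ OPEN, skeleton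
v5 941dddb108cbaacf STANDS; counts unmoved (typed 28∕28 · discharged 5∕27); no count claim.  One finite `𝕋⁴_{L^K}` programme at fixed `ε = L^{−K}`, Bałaban AS PRINTED; the YM mass gap
(Clay) is NOT proved by any of this — R4 closes the conditional finite-𝕋⁴ rung `BalabanLadder.UV` only; NOT ℝ⁴, NOT OS.  Sources (bookkeeping only): [Balaban1988Convergent] (1.1)
p.244, (2.18) p.257; [Balaban1989LargeFieldII] (1.80) p.384.  No decl carries a cite tag.
-/

set_option autoImplicit false

noncomputable section

open Finset

namespace Summit.QuantumFields.YangMills.BalabanUVNodes.N20BlockCaricatureAffinity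

/-! ## §1 Two finite laws on one index set: the affinity sandwiches the total variation -/

section TwoLaws

variable {ι : Type*} (T : Finset ι) {a b : ι → ℝ}

/-- The overlap `Σ min(a, b)` is at most the Bhattacharyya AFFINITY `Σ √(a·b)` (termwise: the minimum of two non-negative reals is below their geometric mean —
the one-line fact `min_le_sqrt_mul` of the tree's `Literature/Analysis/FluidPDE/DriftMildBootstrap`, inlined here rather than importing a fluid-PDE module). [folklore] -/
theorem sum_min_le_affinity (ha : ∀ i ∈ T, 0 ≤ a i) (hb : ∀ i ∈ T, 0 ≤ b i) :
    ∑ i ∈ T, min (a i) (b i) ≤ ∑ i ∈ T, Real.sqrt (a i * b i) := by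
  refine Finset.sum_le_sum fun i hi => ?_
  have hm : 0 ≤ min (a i) (b i) := le_min (ha i hi) (hb i hi)
  calc min (a i) (b i) = Real.sqrt (min (a i) (b i) * min (a i) (b i)) := (Real.sqrt_mul_self hm).symm
    _ ≤ Real.sqrt (a i * b i) := Real.sqrt_le_sqrt (mul_le_mul (min_le_left _ _) (min_le_right _ _) hm (ha i hi))

/-- ★ **TV ≥ 1 − BC** [folklore]: for non-negative `a, b` on `T` with `Σ_T b = 1`, the set `{a < b}` carries `b`-mass minus `a`-mass at least `1 − Σ_T √(a·b)`. -/
theorem exists_subset_one_sub_affinity_le (ha : ∀ i ∈ T, 0 ≤ a i) (hb : ∀ i ∈ T, 0 ≤ b i) (hbT : ∑ i ∈ T, b i = 1) :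
    ∃ S, S ⊆ T ∧ 1 - ∑ i ∈ T, Real.sqrt (a i * b i) ≤ ∑ i ∈ S, b i - ∑ i ∈ S, a i := by
  classical
  refine ⟨T.filter (fun i => a i < b i), Finset.filter_subset _ _, ?_⟩
  have key : ∑ i ∈ T.filter (fun i => a i < b i), b i - ∑ i ∈ T.filter (fun i => a i < b i), a i =
      ∑ i ∈ T, b i - ∑ i ∈ T, min (a i) (b i) := by
    rw [← Finset.sum_sub_distrib, ← Finset.sum_sub_distrib, Finset.sum_filter]
    refine Finset.sum_congr rfl fun i _ => ?_
    split_ifs with h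
    · rw [min_eq_left h.le]
    · rw [min_eq_right (not_lt.1 h), sub_self]
  rw [key, hbT]
  linarith [sum_min_le_affinity T ha hb]

/-- Equal totals ⇒ the signed mass of every `S ⊆ T` is at most HALF the `ℓ¹` distance: `|Σ_S b − Σ_S a| ≤ ½ Σ_T |b − a|`. [folklore] -/
theorem abs_sub_le_half_sum_abs (hab : ∑ i ∈ T, a i = ∑ i ∈ T, b i) {S : Finset ι} (hS : S ⊆ T) :
    |∑ i ∈ S, b i - ∑ i ∈ S, a i| ≤ (∑ i ∈ T, |b i - a i|) / 2 := by
  classical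
  have hsplit := Finset.sum_sdiff hS (f := fun i => b i - a i)
  have hsplit' := Finset.sum_sdiff hS (f := fun i => |b i - a i|)
  have hT0 : ∑ i ∈ T, (b i - a i) = 0 := by rw [Finset.sum_sub_distrib]; linarith
  have h1 : |∑ i ∈ S, (b i - a i)| ≤ ∑ i ∈ S, |b i - a i| := Finset.abs_sum_le_sum_abs _ _
  have h2 : |∑ i ∈ T \ S, (b i - a i)| ≤ ∑ i ∈ T \ S, |b i - a i| := Finset.abs_sum_le_sum_abs _ _
  have h3 : ∑ i ∈ T \ S, (b i - a i) = -∑ i ∈ S, (b i - a i) := by linarith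
  rw [h3, abs_neg] at h2
  rw [← Finset.sum_sub_distrib]
  linarith

/-- Cauchy–Schwarz on `|b − a| = |√b − √a|·(√b + √a)`: `(Σ_T |b − a|)² ≤ (Σ_T (√a − √b)²)·(Σ_T (√a + √b)²)`. [folklore] -/
theorem sq_sum_abs_sub_le (ha : ∀ i ∈ T, 0 ≤ a i) (hb : ∀ i ∈ T, 0 ≤ b i) :
    (∑ i ∈ T, |b i - a i|) ^ 2 ≤ (∑ i ∈ T, (Real.sqrt (a i) - Real.sqrt (b i)) ^ 2) * ∑ i ∈ T, (Real.sqrt (a i) + Real.sqrt (b i)) ^ 2 :=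
  Finset.sum_sq_le_sum_mul_sum_of_sq_le_mul T (fun _ _ => sq_nonneg _) (fun _ _ => sq_nonneg _) fun i hi => by
    have e : b i - a i = (Real.sqrt (b i) + Real.sqrt (a i)) * (Real.sqrt (b i) - Real.sqrt (a i)) := by
      rw [← sq_sub_sq, Real.sq_sqrt (hb i hi), Real.sq_sqrt (ha i hi)]
    rw [sq_abs, e]
    exact le_of_eq (by ring)

/-- `Σ_T (√a − √b)² = Σ_T a + Σ_T b − 2·Σ_T √(a·b)`. [folklore] -/
theorem sum_sq_sqrt_sub (ha : ∀ i ∈ T, 0 ≤ a i) (hb : ∀ i ∈ T, 0 ≤ b i) :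
    ∑ i ∈ T, (Real.sqrt (a i) - Real.sqrt (b i)) ^ 2 = ∑ i ∈ T, a i + ∑ i ∈ T, b i - 2 * ∑ i ∈ T, Real.sqrt (a i * b i) := by
  have h : ∀ i ∈ T, (Real.sqrt (a i) - Real.sqrt (b i)) ^ 2 = a i + b i - 2 * Real.sqrt (a i * b i) := fun i hi => by
    rw [sub_sq, Real.sq_sqrt (ha i hi), Real.sq_sqrt (hb i hi), Real.sqrt_mul (ha i hi)]; ring
  rw [Finset.sum_congr rfl h, Finset.sum_sub_distrib, Finset.sum_add_distrib, Finset.mul_sum]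

/-- `Σ_T (√a + √b)² = Σ_T a + Σ_T b + 2·Σ_T √(a·b)`. [folklore] -/
theorem sum_sq_sqrt_add (ha : ∀ i ∈ T, 0 ≤ a i) (hb : ∀ i ∈ T, 0 ≤ b i) :
    ∑ i ∈ T, (Real.sqrt (a i) + Real.sqrt (b i)) ^ 2 = ∑ i ∈ T, a i + ∑ i ∈ T, b i + 2 * ∑ i ∈ T, Real.sqrt (a i * b i) := by
  have h : ∀ i ∈ T, (Real.sqrt (a i) + Real.sqrt (b i)) ^ 2 = a i + b i + 2 * Real.sqrt (a i * b i) := fun i hi => by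
    rw [add_sq, Real.sq_sqrt (ha i hi), Real.sq_sqrt (hb i hi), Real.sqrt_mul (ha i hi)]; ring
  rw [Finset.sum_congr rfl h, Finset.sum_add_distrib, Finset.sum_add_distrib, Finset.mul_sum]

/-- ★ **TV ≤ √(1 − BC²)** [folklore] (Le Cam): for two probability weight functions `a, b ≥ 0` on `T` (totals `1`) and EVERY `S ⊆ T`,
`|Σ_S b − Σ_S a| ≤ √(1 − (Σ_T √(a·b))²)`. -/
theorem abs_sub_le_sqrt_one_sub_affinity_sq (ha : ∀ i ∈ T, 0 ≤ a i) (hb : ∀ i ∈ T, 0 ≤ b i)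
    (haT : ∑ i ∈ T, a i = 1) (hbT : ∑ i ∈ T, b i = 1) {S : Finset ι} (hS : S ⊆ T) :
    |∑ i ∈ S, b i - ∑ i ∈ S, a i| ≤ Real.sqrt (1 - (∑ i ∈ T, Real.sqrt (a i * b i)) ^ 2) := by
  apply Real.le_sqrt_of_sq_le
  have h1 := abs_sub_le_half_sum_abs T (haT.trans hbT.symm) hS
  have h2 := sq_sum_abs_sub_le T ha hb
  rw [sum_sq_sqrt_sub T ha hb, sum_sq_sqrt_add T ha hb, haT, hbT] at h2
  have h3 : |∑ i ∈ S, b i - ∑ i ∈ S, a i| ^ 2 ≤ ((∑ i ∈ T, |b i - a i|) / 2) ^ 2 :=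
    pow_le_pow_left₀ (abs_nonneg _) h1 2
  calc |∑ i ∈ S, b i - ∑ i ∈ S, a i| ^ 2 ≤ ((∑ i ∈ T, |b i - a i|) / 2) ^ 2 := h3
    _ = (∑ i ∈ T, |b i - a i|) ^ 2 / 4 := by ring
    _ ≤ (1 + 1 - 2 * ∑ i ∈ T, Real.sqrt (a i * b i)) * (1 + 1 + 2 * ∑ i ∈ T, Real.sqrt (a i * b i)) / 4 :=
        div_le_div_of_nonneg_right h2 (by norm_num)
    _ = 1 - (∑ i ∈ T, Real.sqrt (a i * b i)) ^ 2 := by ring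

end TwoLaws

/-! ## §2 The independent-block caricature: configuration weights, totals, affinity -/

section Caricature

variable {p q : ℝ}

/-- The configuration weights of `n` independent Bernoulli(`p`) blocks sum to `1` (binomial theorem over the powerset, `Finset.sum_pow_mul_eq_add_pow`). [folklore] -/
theorem sum_config_eq_one (p : ℝ) (n : ℕ) :
    ∑ S ∈ (Finset.range n).powerset, p ^ S.card * (1 - p) ^ (n - S.card) = 1 := by
  have h := Finset.sum_pow_mul_eq_add_pow p (1 - p) (Finset.range n)
  rw [Finset.card_range] at h
  rw [h, add_sub_cancel, one_pow]

/-- Configuration weights are non-negative for `p ∈ [0, 1]`. [folklore] -/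
theorem config_nonneg (hp0 : 0 ≤ p) (hp1 : p ≤ 1) (n : ℕ) (S : Finset ℕ) : 0 ≤ p ^ S.card * (1 - p) ^ (n - S.card) :=
  mul_nonneg (pow_nonneg hp0 _) (pow_nonneg (sub_nonneg.2 hp1) _)

/-- The geometric mean of the two runs' configuration weights FACTORS over the blocks (`√(x^k) = (√x)^k` for `x ≥ 0` — the tree's `Literature/NumberTheory/Automorphic`
`real_sqrt_pow`, a two-line fact inlined here rather than importing an automorphic-forms module). [folklore] -/
theorem sqrt_config_mul_config (hp0 : 0 ≤ p) (hq0 : 0 ≤ q) (hp1 : p ≤ 1) (hq1 : q ≤ 1) (n : ℕ) (S : Finset ℕ) :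
    Real.sqrt (p ^ S.card * (1 - p) ^ (n - S.card) * (q ^ S.card * (1 - q) ^ (n - S.card))) =
      Real.sqrt (p * q) ^ S.card * Real.sqrt ((1 - p) * (1 - q)) ^ (n - S.card) := by
  have hsq : ∀ {x : ℝ}, 0 ≤ x → ∀ k : ℕ, Real.sqrt (x ^ k) = Real.sqrt x ^ k := fun {x} hx k =>
    calc Real.sqrt (x ^ k) = Real.sqrt ((Real.sqrt x ^ k) ^ 2) := by rw [← pow_mul, mul_comm, pow_mul, Real.sq_sqrt hx]
      _ = Real.sqrt x ^ k := Real.sqrt_sq (pow_nonneg (Real.sqrt_nonneg _) _)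
  have e : p ^ S.card * (1 - p) ^ (n - S.card) * (q ^ S.card * (1 - q) ^ (n - S.card)) =
      (p * q) ^ S.card * ((1 - p) * (1 - q)) ^ (n - S.card) := by rw [mul_pow, mul_pow]; ring
  rw [e, Real.sqrt_mul' _ (pow_nonneg (mul_nonneg (sub_nonneg.2 hp1) (sub_nonneg.2 hq1)) _),
    hsq (mul_nonneg hp0 hq0), hsq (mul_nonneg (sub_nonneg.2 hp1) (sub_nonneg.2 hq1))]

/-- ★ **THE AFFINITY OF THE CARICATURE IS A POWER**: `Σ_{S ⊆ range n} √(A_S·B_S) = (√(pq) + √((1−p)(1−q)))^n` — the Bhattacharyya affinity is MULTIPLICATIVE over independent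
blocks (the per-block affinity `u = √(pq) + √((1−p)(1−q))` to the `n`-th power). [folklore] -/
theorem affinity_config_eq_pow (hp0 : 0 ≤ p) (hq0 : 0 ≤ q) (hp1 : p ≤ 1) (hq1 : q ≤ 1) (n : ℕ) :
    ∑ S ∈ (Finset.range n).powerset, Real.sqrt (p ^ S.card * (1 - p) ^ (n - S.card) * (q ^ S.card * (1 - q) ^ (n - S.card))) =
      (Real.sqrt (p * q) + Real.sqrt ((1 - p) * (1 - q))) ^ n := by
  rw [Finset.sum_congr rfl fun S _ => sqrt_config_mul_config hp0 hq0 hp1 hq1 n S]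
  have h := Finset.sum_pow_mul_eq_add_pow (Real.sqrt (p * q)) (Real.sqrt ((1 - p) * (1 - q))) (Finset.range n)
  rwa [Finset.card_range] at h

end Caricature

/-! ## §3 One block: the per-block affinity `u` against the per-block statistic `(q − p)²·(1∕(p + q) + 1∕(2 − p − q))` -/

section OneBlock

variable {p q : ℝ}

/-- `(√p − √q)² ≤ (q − p)² ∕ (p + q)` for `p, q ≥ 0` (with `x ∕ 0 = 0`: at `p = q = 0` both sides vanish). [folklore] -/
theorem sq_sqrt_sub_sqrt_le (hp0 : 0 ≤ p) (hq0 : 0 ≤ q) : (Real.sqrt p - Real.sqrt q) ^ 2 ≤ (q - p) ^ 2 / (p + q) := by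
  rcases (add_nonneg hp0 hq0).eq_or_lt with h0 | hpos
  · have hp : p = 0 := by linarith
    have hq : q = 0 := by linarith
    subst hp; subst hq; simp
  · rw [le_div_iff₀ hpos]
    have e : (q - p) ^ 2 = (Real.sqrt p - Real.sqrt q) ^ 2 * (Real.sqrt p + Real.sqrt q) ^ 2 := by
      have : q - p = (Real.sqrt q + Real.sqrt p) * (Real.sqrt q - Real.sqrt p) := by
        rw [← sq_sub_sq, Real.sq_sqrt hq0, Real.sq_sqrt hp0]
      rw [this]; ring
    rw [e]
    refine mul_le_mul_of_nonneg_left ?_ (sq_nonneg _)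
    rw [add_sq, Real.sq_sqrt hp0, Real.sq_sqrt hq0]
    nlinarith [mul_nonneg (Real.sqrt_nonneg p) (Real.sqrt_nonneg q)]

/-- `(q − p)² ∕ (p + q) ∕ 2 ≤ (√p − √q)²` for `p, q ≥ 0` (AM–GM: `(√p + √q)² ≤ 2(p + q)`). [folklore] -/
theorem div_two_le_sq_sqrt_sub_sqrt (hp0 : 0 ≤ p) (hq0 : 0 ≤ q) : (q - p) ^ 2 / (p + q) / 2 ≤ (Real.sqrt p - Real.sqrt q) ^ 2 := by
  rcases (add_nonneg hp0 hq0).eq_or_lt with h0 | hpos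
  · have hp : p = 0 := by linarith
    have hq : q = 0 := by linarith
    subst hp; subst hq; simp
  · rw [div_div, div_le_iff₀ (by positivity)]
    have e : (q - p) ^ 2 = (Real.sqrt p - Real.sqrt q) ^ 2 * (Real.sqrt p + Real.sqrt q) ^ 2 := by
      have : q - p = (Real.sqrt q + Real.sqrt p) * (Real.sqrt q - Real.sqrt p) := by
        rw [← sq_sub_sq, Real.sq_sqrt hq0, Real.sq_sqrt hp0]
      rw [this]; ring
    rw [e]
    refine mul_le_mul_of_nonneg_left ?_ (sq_nonneg _)
    have h := sq_nonneg (Real.sqrt p - Real.sqrt q)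
    rw [sub_sq, Real.sq_sqrt hp0, Real.sq_sqrt hq0] at h
    rw [add_sq, Real.sq_sqrt hp0, Real.sq_sqrt hq0]
    linarith

/-- The per-block Hellinger identity: `1 − (√(pq) + √((1−p)(1−q))) = ((√p − √q)² + (√(1−p) − √(1−q))²) ∕ 2`. [folklore] -/
theorem one_sub_affinity₁_eq (hp0 : 0 ≤ p) (hq0 : 0 ≤ q) (hp1 : p ≤ 1) (hq1 : q ≤ 1) :
    1 - (Real.sqrt (p * q) + Real.sqrt ((1 - p) * (1 - q))) =
      ((Real.sqrt p - Real.sqrt q) ^ 2 + (Real.sqrt (1 - p) - Real.sqrt (1 - q)) ^ 2) / 2 := by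
  rw [sub_sq, sub_sq, Real.sq_sqrt hp0, Real.sq_sqrt hq0, Real.sq_sqrt (sub_nonneg.2 hp1), Real.sq_sqrt (sub_nonneg.2 hq1),
    Real.sqrt_mul hp0, Real.sqrt_mul (sub_nonneg.2 hp1)]
  ring

/-- ★ **LOWER AFFINITY DEFECT**: `Λ₁ ∕ 4 ≤ 1 − u`, `Λ₁ = (q−p)²∕(p+q) + (q−p)²∕(2−p−q)`, `u = √(pq) + √((1−p)(1−q))`. [folklore] -/
theorem stat_div_four_le_one_sub_affinity₁ (hp0 : 0 ≤ p) (hq0 : 0 ≤ q) (hp1 : p ≤ 1) (hq1 : q ≤ 1) :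
    ((q - p) ^ 2 / (p + q) + (q - p) ^ 2 / (2 - p - q)) / 4 ≤ 1 - (Real.sqrt (p * q) + Real.sqrt ((1 - p) * (1 - q))) := by
  rw [one_sub_affinity₁_eq hp0 hq0 hp1 hq1]
  have h1 := div_two_le_sq_sqrt_sub_sqrt hp0 hq0
  have h2 := div_two_le_sq_sqrt_sub_sqrt (sub_nonneg.2 hp1) (sub_nonneg.2 hq1)
  have e2 : ((1 - q) - (1 - p)) ^ 2 / ((1 - p) + (1 - q)) = (q - p) ^ 2 / (2 - p - q) := by
    rw [show ((1 - q) - (1 - p)) ^ 2 = (q - p) ^ 2 by ring, show (1 - p) + (1 - q) = 2 - p - q by ring]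
  rw [e2] at h2
  linarith

/-- ★ **UPPER AFFINITY DEFECT**: `1 − u ≤ Λ₁ ∕ 2`. [folklore] -/
theorem one_sub_affinity₁_le_stat_div_two (hp0 : 0 ≤ p) (hq0 : 0 ≤ q) (hp1 : p ≤ 1) (hq1 : q ≤ 1) :
    1 - (Real.sqrt (p * q) + Real.sqrt ((1 - p) * (1 - q))) ≤ ((q - p) ^ 2 / (p + q) + (q - p) ^ 2 / (2 - p - q)) / 2 := by
  rw [one_sub_affinity₁_eq hp0 hq0 hp1 hq1]
  have h1 := sq_sqrt_sub_sqrt_le hp0 hq0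
  have h2 := sq_sqrt_sub_sqrt_le (sub_nonneg.2 hp1) (sub_nonneg.2 hq1)
  have e2 : ((1 - q) - (1 - p)) ^ 2 / ((1 - p) + (1 - q)) = (q - p) ^ 2 / (2 - p - q) := by
    rw [show ((1 - q) - (1 - p)) ^ 2 = (q - p) ^ 2 by ring, show (1 - p) + (1 - q) = 2 - p - q by ring]
  rw [e2] at h2
  linarith

/-- The per-block affinity is non-negative. [folklore] -/
theorem affinity₁_nonneg (p q : ℝ) : 0 ≤ Real.sqrt (p * q) + Real.sqrt ((1 - p) * (1 - q)) :=
  add_nonneg (Real.sqrt_nonneg _) (Real.sqrt_nonneg _)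

/-- The per-block statistic is non-negative on `[0, 1]²`. [folklore] -/
theorem stat₁_nonneg (hp0 : 0 ≤ p) (hq0 : 0 ≤ q) (hp1 : p ≤ 1) (hq1 : q ≤ 1) :
    0 ≤ (q - p) ^ 2 / (p + q) + (q - p) ^ 2 / (2 - p - q) :=
  add_nonneg (div_nonneg (sq_nonneg _) (add_nonneg hp0 hq0)) (div_nonneg (sq_nonneg _) (by linarith))

/-- CRIT-1's one-sided letter is below the symmetric one: `(q−p)²∕(p+q) ≤ Λ₁`. [folklore] -/
theorem stat₁_le_statSym₁ (hp1 : p ≤ 1) (hq1 : q ≤ 1) :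
    (q - p) ^ 2 / (p + q) ≤ (q - p) ^ 2 / (p + q) + (q - p) ^ 2 / (2 - p - q) :=
  le_add_of_nonneg_right (div_nonneg (sq_nonneg _) (by linarith))

/-- … and dominates it up to a factor `2` in the rare-event regime `p + q ≤ 1`: `Λ₁ ≤ 2·(q−p)²∕(p+q)`. [folklore] -/
theorem statSym₁_le_two_stat₁ (hp0 : 0 ≤ p) (hq0 : 0 ≤ q) (hpq : p + q ≤ 1) :
    (q - p) ^ 2 / (p + q) + (q - p) ^ 2 / (2 - p - q) ≤ 2 * ((q - p) ^ 2 / (p + q)) := by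
  rcases (add_nonneg hp0 hq0).eq_or_lt with h0 | hpos
  · have hp : p = 0 := by linarith
    have hq : q = 0 := by linarith
    subst hp; subst hq; simp
  · have h : (q - p) ^ 2 / (2 - p - q) ≤ (q - p) ^ 2 / (p + q) :=
      div_le_div_of_nonneg_left (sq_nonneg _) hpos (by linarith)
    linarith

end OneBlock

end Summit.QuantumFields.YangMills.BalabanUVNodes.N20BlockCaricatureAffinity

end
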